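import Literature.MathematicalPhysics.QuantumFieldTheory.Balaban1983to89.Step
import Literature.MathematicalPhysics.QuantumFieldTheory.Balaban1983to89.B14

/-!
# T4 / node U5a (SYNCHRONISATION, D8) — the comparability arithmetic behind the IR-anchored choice of thresholds

Cell `pub-balaban`, T4-DAG v1 node U5a / design principle D8; companion of the census `t4/T4-XREAD-U5a.md` v1
(§4(ii) there).  WHAT THIS IS NOT: rung (B)+1 scoping only; NOT infinite volume, NOT mass gap, NOT Clay; no theorem
of the audited series [Balaban1987RG1]–[Balaban1989LargeFieldII] is asserted or used.  Value = kernel-checked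
bookkeeping arithmetic, NOT summit progress.

THE POINT (design D8, OUR analysis — not a printed claim).  In [Balaban1988Convergent] every g-dependent threshold of
the k-th step is an explicit function of the k-th coupling constant: *"ε_j = g_j A₀ (log g_j⁻²)^{p₀} = g_j p₀(g_j)"*
((2.4) p.255), *"R_j is the smallest number of the form L^r such, that R_j ≥ (log g_j⁻²)^r"* ((2.5) p.255),
*"α_{0,j} = g_j C₀ (log g_j⁻²)^{q₀}, α_{1,j} = g_j C₁ (log g_j⁻²)^{q₁}"* ((2.28) p.259), *"δ_k = g_k A₁/A₀ p₀(g_k)"*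
(p.265) — tree `p0Profile`, `epsK`, `deltaK`, `B14.IsRj`, `B14.alphaJ`.  To compare two runs of the procedure
(K steps from spacing L^{-K}, K+1 steps from L^{-(K+1)}) at equal physical scale one wants both runs to use
LITERALLY the same thresholds, i.e. thresholds evaluated at a K-independent REFERENCE sequence `ḡ_n`, `n = K − k`
the IR-anchored index, instead of at the realised `g_k`.  What the printed proofs use of the realised coupling
relative to the thresholds is only two-sided comparability (census §3), and that is what this file supplies, from
the discrete form of [Balaban1987RG1] (0.31) p.259 — tree `Step.Discrete031 b β' K g gs`:
`1/g² + b (K−k) ≤ 1/gs_k² ≤ 1/g² + β' (K−k)` — for the run, and the same sandwich in the IR index for the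
reference (`RefSandwich`, a HYPOTHESIS on `ḡ`, with the constructed instance `oneLoopRef`):

* `sync_sq_ratio` : `b·gs_k² ≤ β'·ḡ_{K−k}²` and `b·ḡ_{K−k}² ≤ β'·gs_k²` for all `k ≤ K` (c₀² = β'/b, uniform in K, k);
* `sync_log_le` : `log gs_k⁻² ≤ log ḡ_{K−k}⁻² + log(β'/b)` and symmetrically;
* `pow_log_transfer`, `sync_profile_le` : the (2.7)-type transfer `(log gs_k⁻²)^p ≤ (1+θ)^p (log ḡ_{K−k}⁻²)^p`
  once `log(β'/b) ≤ θ · log ḡ_{K−k}⁻²` (a "g sufficiently small" clause of the printed kind);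
* `sync_eps_sq_le` : the ε-comparability `b · ε(gs_k)² ≤ β' (1+θ)^{2p₀} · ε(ḡ_{K−k})²` with `ε(x) = x · p0Profile A₀ p₀ x`;
* `oneLoopRef`, `refSandwich_oneLoopRef` : the backward one-loop reference `ḡ_n = √((1/g² + b̄ n)⁻¹)` satisfies
  `RefSandwich b β' g ḡ` whenever `b ≤ b̄ ≤ β'` — an instance, so no existence is smuggled into the hypothesis.

Everything is elementary real arithmetic; no `sorry`, no new notion, no cited fact beyond the locator docstrings.

v1.1 ADDENDUM (append-only; v1 declarations byte-unchanged; `B14` now imported for `B14.IsRj`, `B14.alphaJ`):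
* `isRj_le_mul_of_profile` : the (2.9)-shape transfer for the radii — `IsRj L r x Rx`, `IsRj L r y Ry`,
  `(log x⁻²)^r ≤ (1+θ)^r (log y⁻²)^r` and the smallness clause `(1+θ)^r ≤ L` give `Rx ≤ L · Ry`
  (*"R_n ≤ L R_m"*, (2.9) p.256, here between the realised and the reference scale); `sync_R_le` packages it with
  `sync_profile_le`;
* `alphaJ_eq_mul_p0Profile` : `B14.alphaJ C q x = x · p0Profile C q x`, so `sync_eps_sq_le` (generic in the
  amplitude and the exponent) serves verbatim for *"δ'_j = g_j A₁ p₁(g_j)"* ([Balaban1989LargeFieldI] (1.27) p.183)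
  and for `α_{0,j}`, `α_{1,j}` of (2.28).
-/

namespace Literature.MathematicalPhysics.QuantumFieldTheory.Balaban1983to89.T4SyncThresholds

open Literature.MathematicalPhysics.QuantumFieldTheory.Balaban1983to89

/-- The (0.31)-type sandwich for a REFERENCE sequence indexed by the IR-anchored index `n = K − k`:
`1/g² + b n ≤ 1/ḡ_n² ≤ 1/g² + β' n` for every `n`.  A hypothesis on the design object `ḡ` (census §4(i));
`refSandwich_oneLoopRef` constructs an instance. [cite: Balaban1987RG1, (0.31) p.259] -/
def RefSandwich (b β' g : ℝ) (gbar : ℕ → ℝ) : Prop :=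
  ∀ n : ℕ, 1 / g ^ 2 + b * (n : ℝ) ≤ 1 / (gbar n) ^ 2 ∧ 1 / (gbar n) ^ 2 ≤ 1 / g ^ 2 + β' * (n : ℝ)

/-- Core arithmetic: if `a + b t ≤ 1/x²` and `1/y² ≤ a + β t` with `a ≥ 0`, `0 < b ≤ β`, `x, y > 0`, then
`b x² ≤ β y²`. [folklore] -/
theorem sq_cross_bound {x y a t b β : ℝ} (hx : 0 < x) (hy : 0 < y) (ha : 0 ≤ a) (hb : 0 < b)
    (hbβ : b ≤ β) (hlo : a + b * t ≤ 1 / x ^ 2) (hhi : 1 / y ^ 2 ≤ a + β * t) : b * x ^ 2 ≤ β * y ^ 2 := by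
  have hβ0 : 0 ≤ β := le_trans (le_of_lt hb) hbβ
  have h1 : b * (1 / y ^ 2) ≤ β * (1 / x ^ 2) :=
    calc b * (1 / y ^ 2) ≤ b * (a + β * t) := mul_le_mul_of_nonneg_left hhi (le_of_lt hb)
      _ = b * a + β * (b * t) := by ring
      _ ≤ β * a + β * (b * t) := by
          have := mul_le_mul_of_nonneg_right hbβ ha
          linarith
      _ = β * (a + b * t) := by ring
      _ ≤ β * (1 / x ^ 2) := mul_le_mul_of_nonneg_left hlo hβ0
  have hx2 : 0 < x ^ 2 := by positivity
  have hy2 : 0 < y ^ 2 := by positivity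
  have h2 : b * (1 / y ^ 2) * (x ^ 2 * y ^ 2) ≤ β * (1 / x ^ 2) * (x ^ 2 * y ^ 2) :=
    mul_le_mul_of_nonneg_right h1 (by positivity)
  have e1 : b * (1 / y ^ 2) * (x ^ 2 * y ^ 2) = b * x ^ 2 := by field_simp
  have e2 : β * (1 / x ^ 2) * (x ^ 2 * y ^ 2) = β * y ^ 2 := by field_simp
  linarith [h2, e1, e2]

/-- **Synchronisation comparability** (census §4(ii)): the realised couplings of a run satisfying the discrete (0.31)
and a reference sequence satisfying the same sandwich in the IR index are two-sidedly comparable at equal physical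
scale, with the K- and k-independent constant `c₀² = β'/b`:
`b·gs_k² ≤ β'·ḡ_{K−k}²` and `b·ḡ_{K−k}² ≤ β'·gs_k²` for `k ≤ K`. [cite: Balaban1987RG1, (0.31) p.259] -/
theorem sync_sq_ratio {K : ℕ} {gs gbar : ℕ → ℝ} {b β' g : ℝ} (h : Step.Discrete031 b β' K g gs)
    (href : RefSandwich b β' g gbar) (hb : 0 < b) (hbβ : b ≤ β') (hg : 0 < g)
    (hpos : ∀ k, k ≤ K → 0 < gs k) (hbar : ∀ n, 0 < gbar n) {k : ℕ} (hk : k ≤ K) :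
    b * (gs k) ^ 2 ≤ β' * (gbar (K - k)) ^ 2 ∧ b * (gbar (K - k)) ^ 2 ≤ β' * (gs k) ^ 2 := by
  have hrun := h k hk
  have hre := href (K - k)
  have hcast : ((K - k : ℕ) : ℝ) = (K : ℝ) - k := Nat.cast_sub hk
  rw [hcast] at hre
  have ha : 0 ≤ 1 / g ^ 2 := by positivity
  exact ⟨sq_cross_bound (hpos k hk) (hbar (K - k)) ha hb hbβ hrun.1 hre.2,
    sq_cross_bound (hbar (K - k)) (hpos k hk) ha hb hbβ hre.1 hrun.2⟩

/-- Log form of `sync_sq_ratio`: `log gs_k⁻² ≤ log ḡ_{K−k}⁻² + log(β'/b)` and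
`log ḡ_{K−k}⁻² ≤ log gs_k⁻² + log(β'/b)`. [folklore] -/
theorem sync_log_le {K : ℕ} {gs gbar : ℕ → ℝ} {b β' g : ℝ} (h : Step.Discrete031 b β' K g gs)
    (href : RefSandwich b β' g gbar) (hb : 0 < b) (hbβ : b ≤ β') (hg : 0 < g)
    (hpos : ∀ k, k ≤ K → 0 < gs k) (hbar : ∀ n, 0 < gbar n) {k : ℕ} (hk : k ≤ K) :
    Real.log ((gs k) ^ 2)⁻¹ ≤ Real.log ((gbar (K - k)) ^ 2)⁻¹ + Real.log (β' / b) ∧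
    Real.log ((gbar (K - k)) ^ 2)⁻¹ ≤ Real.log ((gs k) ^ 2)⁻¹ + Real.log (β' / b) := by
  obtain ⟨h1, h2⟩ := sync_sq_ratio h href hb hbβ hg hpos hbar hk
  have hx : 0 < gs k := hpos k hk
  have hy : 0 < gbar (K - k) := hbar (K - k)
  have hβ : 0 < β' := lt_of_lt_of_le hb hbβ
  have hx2 : 0 < (gs k) ^ 2 := by positivity
  have hy2 : 0 < (gbar (K - k)) ^ 2 := by positivity
  have key : ∀ {u v : ℝ}, 0 < u → 0 < v → b * v ≤ β' * u →
      Real.log u⁻¹ ≤ Real.log v⁻¹ + Real.log (β' / b) := by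
    intro u v hu hv huv
    have h3 : u⁻¹ ≤ (β' / b) * v⁻¹ := by
      rw [inv_eq_one_div, inv_eq_one_div, div_le_iff₀ hu]
      calc (1 : ℝ) = (β' / b) * (1 / v) * (b * v / β') := by field_simp
        _ ≤ (β' / b) * (1 / v) * (β' * u / β') := by
            apply mul_le_mul_of_nonneg_left _ (by positivity)
            exact div_le_div_of_nonneg_right huv (le_of_lt hβ)
        _ = (β' / b) * (1 / v) * u := by field_simp
    calc Real.log u⁻¹ ≤ Real.log ((β' / b) * v⁻¹) :=
          Real.log_le_log (by positivity) h3
      _ = Real.log (β' / b) + Real.log v⁻¹ :=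
          Real.log_mul (ne_of_gt (by positivity)) (ne_of_gt (by positivity))
      _ = Real.log v⁻¹ + Real.log (β' / b) := by ring
  exact ⟨key hx2 hy2 h2, key hy2 hx2 h1⟩

/-- The (2.7)-type transfer between two numbers: `log u ≤ log v + c`, `0 ≤ log u`, `c ≤ θ log v`, `θ ≥ 0` give
`(log u)^p ≤ (1+θ)^p (log v)^p`.  With `u = gs_k⁻²`, `v = ḡ_{K−k}⁻²`, `c = log(β'/b)` the side condition
`log(β'/b) ≤ θ · log ḡ⁻²` is a "g sufficiently small" clause. [cite: Balaban1988Convergent, (2.7) p.255] -/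
theorem pow_log_transfer {u v c θ : ℝ} (p : ℕ) (huv : Real.log u ≤ Real.log v + c) (hu : 0 ≤ Real.log u)
    (hc : c ≤ θ * Real.log v) : (Real.log u) ^ p ≤ (1 + θ) ^ p * (Real.log v) ^ p := by
  have h1 : Real.log u ≤ (1 + θ) * Real.log v := by linarith
  calc (Real.log u) ^ p ≤ ((1 + θ) * Real.log v) ^ p := pow_le_pow_left₀ hu h1 p
    _ = (1 + θ) ^ p * (Real.log v) ^ p := mul_pow _ _ _

/-- Profile comparability at synchronised scales: under the hypotheses of `sync_sq_ratio`, `gs_k ≤ 1` and the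
smallness clause `log(β'/b) ≤ θ · log ḡ_{K−k}⁻²`, one has `(log gs_k⁻²)^p ≤ (1+θ)^p (log ḡ_{K−k}⁻²)^p`; and
symmetrically with the roles exchanged (clause on `gs_k`). [cite: Balaban1988Convergent, (2.7) p.255] -/
theorem sync_profile_le {K : ℕ} {gs gbar : ℕ → ℝ} {b β' g θ : ℝ} (p : ℕ) (h : Step.Discrete031 b β' K g gs)
    (href : RefSandwich b β' g gbar) (hb : 0 < b) (hbβ : b ≤ β') (hg : 0 < g)
    (hpos : ∀ k, k ≤ K → 0 < gs k) (hbar : ∀ n, 0 < gbar n) {k : ℕ} (hk : k ≤ K)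
    (hle1 : gs k ≤ 1) (hbar1 : gbar (K - k) ≤ 1)
    (hθ : Real.log (β' / b) ≤ θ * Real.log ((gbar (K - k)) ^ 2)⁻¹)
    (hθ' : Real.log (β' / b) ≤ θ * Real.log ((gs k) ^ 2)⁻¹) :
    (Real.log ((gs k) ^ 2)⁻¹) ^ p ≤ (1 + θ) ^ p * (Real.log ((gbar (K - k)) ^ 2)⁻¹) ^ p ∧
    (Real.log ((gbar (K - k)) ^ 2)⁻¹) ^ p ≤ (1 + θ) ^ p * (Real.log ((gs k) ^ 2)⁻¹) ^ p := by
  obtain ⟨l1, l2⟩ := sync_log_le h href hb hbβ hg hpos hbar hk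
  have hx : 0 < gs k := hpos k hk
  have hy : 0 < gbar (K - k) := hbar (K - k)
  have logx : 0 ≤ Real.log ((gs k) ^ 2)⁻¹ := by
    apply Real.log_nonneg
    rw [one_le_inv₀ (by positivity)]
    calc (gs k) ^ 2 ≤ 1 ^ 2 := pow_le_pow_left₀ (le_of_lt hx) hle1 2
      _ = 1 := one_pow 2
  have logy : 0 ≤ Real.log ((gbar (K - k)) ^ 2)⁻¹ := by
    apply Real.log_nonneg
    rw [one_le_inv₀ (by positivity)]
    calc (gbar (K - k)) ^ 2 ≤ 1 ^ 2 := pow_le_pow_left₀ (le_of_lt hy) hbar1 2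
      _ = 1 := one_pow 2
  exact ⟨pow_log_transfer p l1 logx hθ, pow_log_transfer p l2 logy hθ'⟩

/-- ε-comparability at synchronised scales (census §3, U-mix): from `b x² ≤ β' y²` and the profile transfer
`(log x⁻²)^{p₀} ≤ (1+θ)^{p₀} (log y⁻²)^{p₀}` (left side ≥ 0; no sign condition on `A₀`, `θ` is needed since only squares of them enter):
`b · (x p₀(x))² ≤ β' (1+θ)^{2p₀} · (y p₀(y))²`, `p₀ = p0Profile A₀ p₀`. [cite: Balaban1988Convergent, (2.4), (2.8) pp.255–256] -/
theorem eps_sq_le_of_transfer {x y b β' θ A₀ : ℝ} {p₀ : ℕ} (hb : 0 ≤ b)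
    (hsq : b * x ^ 2 ≤ β' * y ^ 2) (hX : 0 ≤ Real.log (x ^ 2)⁻¹)
    (hprof : (Real.log (x ^ 2)⁻¹) ^ p₀ ≤ (1 + θ) ^ p₀ * (Real.log (y ^ 2)⁻¹) ^ p₀) :
    b * (x * p0Profile A₀ p₀ x) ^ 2 ≤ β' * (1 + θ) ^ (2 * p₀) * (y * p0Profile A₀ p₀ y) ^ 2 := by
  unfold p0Profile
  set X := Real.log (x ^ 2)⁻¹ with hXdef
  set Y := Real.log (y ^ 2)⁻¹ with hYdef
  have hXp : 0 ≤ X ^ p₀ := pow_nonneg hX p₀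
  have hsq2 : (X ^ p₀) ^ 2 ≤ ((1 + θ) ^ p₀ * Y ^ p₀) ^ 2 := pow_le_pow_left₀ hXp hprof 2
  have hβy : 0 ≤ β' * y ^ 2 := le_trans (by positivity) hsq
  have step : b * x ^ 2 * (A₀ ^ 2 * (X ^ p₀) ^ 2) ≤ β' * y ^ 2 * (A₀ ^ 2 * ((1 + θ) ^ p₀ * Y ^ p₀) ^ 2) :=
    mul_le_mul hsq (mul_le_mul_of_nonneg_left hsq2 (by positivity)) (by positivity) hβy
  have e1 : b * (x * (A₀ * X ^ p₀)) ^ 2 = b * x ^ 2 * (A₀ ^ 2 * (X ^ p₀) ^ 2) := by ring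
  have e2 : β' * (1 + θ) ^ (2 * p₀) * (y * (A₀ * Y ^ p₀)) ^ 2 =
      β' * y ^ 2 * (A₀ ^ 2 * ((1 + θ) ^ p₀ * Y ^ p₀) ^ 2) := by ring
  rw [e1, e2]; exact step

/-- **ε-synchronisation bound**: under the hypotheses of `sync_profile_le` (with `p = p₀`),
the printed threshold at the realised coupling and at the reference coupling of the same physical scale satisfy
`b ε(gs_k)² ≤ β'(1+θ)^{2p₀} ε(ḡ_{K−k})²` and `b ε(ḡ_{K−k})² ≤ β'(1+θ)^{2p₀} ε(gs_k)²`. [cite: Balaban1988Convergent, (2.4) p.255] -/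
theorem sync_eps_sq_le {K : ℕ} {gs gbar : ℕ → ℝ} {b β' g θ : ℝ} (A₀ : ℝ) (p₀ : ℕ) (h : Step.Discrete031 b β' K g gs)
    (href : RefSandwich b β' g gbar) (hb : 0 < b) (hbβ : b ≤ β') (hg : 0 < g)
    (hpos : ∀ k, k ≤ K → 0 < gs k) (hbar : ∀ n, 0 < gbar n) {k : ℕ} (hk : k ≤ K)
    (hle1 : gs k ≤ 1) (hbar1 : gbar (K - k) ≤ 1)
    (hθ : Real.log (β' / b) ≤ θ * Real.log ((gbar (K - k)) ^ 2)⁻¹)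
    (hθ' : Real.log (β' / b) ≤ θ * Real.log ((gs k) ^ 2)⁻¹) :
    b * (gs k * p0Profile A₀ p₀ (gs k)) ^ 2 ≤
        β' * (1 + θ) ^ (2 * p₀) * (gbar (K - k) * p0Profile A₀ p₀ (gbar (K - k))) ^ 2 ∧
    b * (gbar (K - k) * p0Profile A₀ p₀ (gbar (K - k))) ^ 2 ≤
        β' * (1 + θ) ^ (2 * p₀) * (gs k * p0Profile A₀ p₀ (gs k)) ^ 2 := by
  obtain ⟨s1, s2⟩ := sync_sq_ratio h href hb hbβ hg hpos hbar hk
  obtain ⟨q1, q2⟩ := sync_profile_le p₀ h href hb hbβ hg hpos hbar hk hle1 hbar1 hθ hθ'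
  have hx : 0 < gs k := hpos k hk
  have hy : 0 < gbar (K - k) := hbar (K - k)
  have logx : 0 ≤ Real.log ((gs k) ^ 2)⁻¹ := by
    apply Real.log_nonneg
    rw [one_le_inv₀ (by positivity)]
    calc (gs k) ^ 2 ≤ 1 ^ 2 := pow_le_pow_left₀ (le_of_lt hx) hle1 2
      _ = 1 := one_pow 2
  have logy : 0 ≤ Real.log ((gbar (K - k)) ^ 2)⁻¹ := by
    apply Real.log_nonneg
    rw [one_le_inv₀ (by positivity)]
    calc (gbar (K - k)) ^ 2 ≤ 1 ^ 2 := pow_le_pow_left₀ (le_of_lt hy) hbar1 2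
      _ = 1 := one_pow 2
  exact ⟨eps_sq_le_of_transfer (le_of_lt hb) s1 logx q1,
    eps_sq_le_of_transfer (le_of_lt hb) s2 logy q2⟩

/-! ## The one-loop reference instance -/

/-- The backward one-loop reference sequence `ḡ_n = √((1/g² + b̄ n)⁻¹)` (census §4(i): any fixed admissible
sequence works; this one makes the sandwich a computation). [folklore] -/
noncomputable def oneLoopRef (bb g : ℝ) (n : ℕ) : ℝ := Real.sqrt ((1 / g ^ 2 + bb * (n : ℝ))⁻¹)

/-- Positivity of the one-loop reference. [folklore] -/
theorem oneLoopRef_pos {bb g : ℝ} (hg : 0 < g) (hbb : 0 ≤ bb) (n : ℕ) : 0 < oneLoopRef bb g n := by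
  unfold oneLoopRef
  apply Real.sqrt_pos.mpr
  have : 0 < 1 / g ^ 2 + bb * (n : ℝ) := by positivity
  positivity

/-- `1/ḡ_n² = 1/g² + b̄ n` for the one-loop reference. [folklore] -/
theorem oneLoopRef_inv_sq {bb g : ℝ} (hg : 0 < g) (hbb : 0 ≤ bb) (n : ℕ) :
    1 / (oneLoopRef bb g n) ^ 2 = 1 / g ^ 2 + bb * (n : ℝ) := by
  unfold oneLoopRef
  have hq : 0 < 1 / g ^ 2 + bb * (n : ℝ) := by positivity
  rw [Real.sq_sqrt (le_of_lt (by positivity))]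
  field_simp

/-- `oneLoopRef b̄ g` satisfies `RefSandwich b β' g` whenever `b ≤ b̄ ≤ β'` (and `g > 0`, `b̄ ≥ 0`). [folklore] -/
theorem refSandwich_oneLoopRef {b bb β' g : ℝ} (hg : 0 < g) (hbb : 0 ≤ bb) (h1 : b ≤ bb) (h2 : bb ≤ β') :
    RefSandwich b β' g (oneLoopRef bb g) := by
  intro n
  rw [oneLoopRef_inv_sq hg hbb n]
  have hn : (0 : ℝ) ≤ n := Nat.cast_nonneg n
  exact ⟨by nlinarith, by nlinarith⟩

/-- At the IR end the reference starts at the renormalised coupling: `ḡ_0 = g`. [folklore] -/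
theorem oneLoopRef_zero {bb g : ℝ} (hg : 0 < g) : oneLoopRef bb g 0 = g := by
  unfold oneLoopRef
  simp only [Nat.cast_zero, mul_zero, add_zero, one_div, inv_inv]
  exact Real.sqrt_sq (le_of_lt hg)

/-! ## v1.1 — radii and the other profiles -/

/-- `B14.alphaJ C q x = x · p0Profile C q x`: the (2.28) amplitudes and B15 (1.27) `δ'_j = g_j A₁ p₁(g_j)` have the
form `x · p0Profile A p x` of `sync_eps_sq_le` (with `(A, p) = (C_i, q_i)` resp. `(A₁, p₁)`). [cite: Balaban1988Convergent, (2.28) p.259] -/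
theorem alphaJ_eq_mul_p0Profile (C : ℝ) (q : ℕ) (x : ℝ) : B14.alphaJ C q x = x * p0Profile C q x := by
  unfold B14.alphaJ p0Profile
  ring

/-- Radii transfer in the (2.9) shape *"R_n ≤ L R_m"*: if `Rx`, `Ry` are the least powers of `L` above
`(log x⁻²)^r`, `(log y⁻²)^r` (`B14.IsRj`), the profiles compare as `(log x⁻²)^r ≤ (1+θ)^r (log y⁻²)^r`, and
`(1+θ)^r ≤ L` (a smallness clause on `θ`, i.e. on g), then `Rx ≤ L · Ry`. [cite: Balaban1988Convergent, (2.5) p.255, (2.9) p.256] -/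
theorem isRj_le_mul_of_profile {L r Rx Ry : ℕ} {x y θ : ℝ} (hL : 1 ≤ L) (hx : B14.IsRj L r x Rx)
    (hy : B14.IsRj L r y Ry)
    (hprof : (Real.log (x ^ 2)⁻¹) ^ r ≤ (1 + θ) ^ r * (Real.log (y ^ 2)⁻¹) ^ r)
    (hθ0 : 0 ≤ (1 + θ) ^ r) (hθL : (1 + θ) ^ r ≤ (L : ℝ)) : (Rx : ℝ) ≤ (L : ℝ) * Ry := by
  obtain ⟨s, hRs, _hsx, hmin⟩ := hx
  obtain ⟨t, hRt, hty, _hmin'⟩ := hy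
  have hLpos : (0 : ℝ) ≤ (L : ℝ) := by positivity
  have hRy0 : (0 : ℝ) ≤ (Ry : ℝ) := by positivity
  -- (log x⁻²)^r ≤ (1+θ)^r (log y⁻²)^r ≤ (1+θ)^r Ry ≤ L Ry = L^(t+1)
  have h1 : (Real.log (x ^ 2)⁻¹) ^ r ≤ ((L ^ (t + 1) : ℕ) : ℝ) := by
    calc (Real.log (x ^ 2)⁻¹) ^ r ≤ (1 + θ) ^ r * (Real.log (y ^ 2)⁻¹) ^ r := hprof
      _ ≤ (1 + θ) ^ r * (Ry : ℝ) := mul_le_mul_of_nonneg_left hty hθ0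
      _ ≤ (L : ℝ) * (Ry : ℝ) := mul_le_mul_of_nonneg_right hθL hRy0
      _ = ((L ^ (t + 1) : ℕ) : ℝ) := by rw [hRt]; push_cast; ring
  have hs : s ≤ t + 1 := hmin (t + 1) h1
  have h2 : (L : ℕ) ^ s ≤ L ^ (t + 1) := Nat.pow_le_pow_right hL hs
  calc (Rx : ℝ) = ((L ^ s : ℕ) : ℝ) := by rw [hRs]
    _ ≤ ((L ^ (t + 1) : ℕ) : ℝ) := by exact_mod_cast h2
    _ = (L : ℝ) * Ry := by rw [hRt]; push_cast; ring

/-- **R-synchronisation bound**: under the hypotheses of `sync_profile_le` with `p = r`, radii `Rk`, `Rbar` chosen by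
the printed rule (2.5) at the realised coupling `gs_k` and at the reference coupling `ḡ_{K−k}`, and the clause
`(1+θ)^r ≤ L`, one has `Rk ≤ L · Rbar` and `Rbar ≤ L · Rk` — two-sided comparability of the radii with the printed
(2.9) constant. [cite: Balaban1988Convergent, (2.9) p.256] -/
theorem sync_R_le {K : ℕ} {gs gbar : ℕ → ℝ} {b β' g θ : ℝ} {L r Rk Rbar : ℕ}
    (h : Step.Discrete031 b β' K g gs) (href : RefSandwich b β' g gbar) (hb : 0 < b) (hbβ : b ≤ β')
    (hg : 0 < g) (hpos : ∀ k, k ≤ K → 0 < gs k) (hbar : ∀ n, 0 < gbar n) {k : ℕ} (hk : k ≤ K)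
    (hle1 : gs k ≤ 1) (hbar1 : gbar (K - k) ≤ 1)
    (hθ : Real.log (β' / b) ≤ θ * Real.log ((gbar (K - k)) ^ 2)⁻¹)
    (hθ' : Real.log (β' / b) ≤ θ * Real.log ((gs k) ^ 2)⁻¹)
    (hL : 1 ≤ L) (hRk : B14.IsRj L r (gs k) Rk) (hRbar : B14.IsRj L r (gbar (K - k)) Rbar)
    (hθ0 : 0 ≤ (1 + θ) ^ r) (hθL : (1 + θ) ^ r ≤ (L : ℝ)) :
    (Rk : ℝ) ≤ (L : ℝ) * Rbar ∧ (Rbar : ℝ) ≤ (L : ℝ) * Rk := by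
  obtain ⟨q1, q2⟩ := sync_profile_le r h href hb hbβ hg hpos hbar hk hle1 hbar1 hθ hθ'
  exact ⟨isRj_le_mul_of_profile hL hRk hRbar q1 hθ0 hθL, isRj_le_mul_of_profile hL hRbar hRk q2 hθ0 hθL⟩

end Literature.MathematicalPhysics.QuantumFieldTheory.Balaban1983to89.T4SyncThresholds
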